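import Summits.ResolutionOfSingularities.ResolutionOfSingularities.Theorems.WildPurityWildSymbolResidualAbsorption
import HarnessLib

/-!
# `WildSymbol` (stmt-ResolutionOfSingularities-17133), line `birth` — calibration by residual absorption

Support file (lead c2, crux cycle 3) for crux #2 of route `ResolutionOfSingularities/WildPurity`
(`Summit.ResolutionOfSingularities.ResolutionOfSingularities.Theses.WildPurity.WildSymbol`). Consequences of the
dévissage theorem `unr_le_unr_of_residual_absorption` (`Theorems/WildPurityWildSymbolResidualAbsorption.lean`:
for valuation rings `O ≤ W` of `K` whose residual place `O/𝔪_W ⊆ κ(W)` absorbs the symbolic `H³_p(κ(W))`,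
`Unr O = Unr W`) for WHERE A WITNESS OF THE CRUX CAN LIVE:

* `divIntegral_of_le` — condition (D) is inherited by every coarsening (`O ≤ W`: the divisorial places tested
  for `(R, W)` are among those tested for `(R, O)`);
* `witness_ascends` — a witness `(R, O, α)` ((D) and (N)) with absorbing residual place at `W ⊇ O` is a witness
  `(R, W, α)`: the COARSEST level at which `α` is non-integral is the essential one, and there the residual place
  must not absorb;
* `not_wildSymbol_below_absorbing_tested_coarsening` — negative lemma in crux language: no witness at any `O`
  having a TESTED coarsening `W` (a DVR essentially of finite type over `k`) with absorbing residual place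
  (`W ⊇ R`, `k ⊆ W`, centre `𝔪_W ∩ R ⊆ 𝔪_O ∩ R` automatically, so (D) gives `α ∈ Unr W = Unr O`);
* `unr_le_unr_of_residual_dvr_of_perfect_residue`, `not_wildSymbol_below_tested_coarsening_with_discrete_perfect_residual`
  — the first concrete instance, by the landed `unr_eq_top_of_dvr_of_perfect_residue`
  (`Theorems/WildPurityWildSymbolArcPlaces.lean`) at the residual level: if the residual place is a DISCRETE
  valuation ring of `κ(W)` with PERFECT residue field, `Unr W ≤ Unr O`; e.g. every rank-two place "a prime
  divisor `E` of a model, then a closed point of `E` (`k` perfect) or a transcendental formal arc on `E`" is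
  exactly as dead as the divisorial place of `E`; `unr_le_unr_of_residual_dense_in_perfect_hull` — the same with
  a residual place at which `κ(W)` is dense in its perfect hull (`unr_eq_top_of_dense_in_perfect_hull`,
  `Theorems/WildPurityWildSymbolPerfectHullDense.lean`).

* `exists_mem_Unr_of_mem_Unr_iSup`, `exists_coarsest_not_mem_Unr` — `Unr` of a directed union of valuation rings is
  exhausted by the `Unr` of its members (symbols have finite support), hence (Zorn over the overrings of `O`) a class
  `α ∉ Unr O` has a COARSEST coarsening `W* ⊇ O` with `α ∉ Unr W*`;
* `witness_at_coarsest_level` — WLOG a witness sits at its coarsest non-integral level `W*`: `(R, W*, α)` is again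
  a witness, `α` is integral at every strictly coarser `W'`, and (dévissage) for every strictly coarser `W'` and
  every residue map of `W'` the residual ring of `W*` does NOT absorb `H³_p(κ(W'))`;
* `wildSymbol_iff_coarsest` — the crux is EQUIVALENT to the existence of a witness that is integral at every strictly
  coarser valuation ring (a free sharpening for re-lining: rank one, or non-absorbing residual places).

Together with the earlier calibrations (no witness at: `O = ⊤`, `O` divisorial, centre of height ≤ 1 on a normal
model, DVRs with perfect residue field, rank-one places dense in the perfect hull, regular centres mod Gros–Suwa)
this reduces the witness hunt to rank one up to residual places that themselves carry non-integral classes.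
No definition is declared; nothing concludes the crux.
-/

noncomputable section

-- single-problem summit: the doubled namespace component `ResolutionOfSingularities` is forced
set_option linter.dupNamespace false

namespace Summit.ResolutionOfSingularities.ResolutionOfSingularities.Theorems.WildSymbol.Birth

open Summit.ResolutionOfSingularities.ResolutionOfSingularities.Theses.WildPurity (WildSymbol)

section Residual

variable {p : ℕ} {K : Type} [Field K]

/-! ## First instance: the residual place is a discrete valuation ring with perfect residue field -/

/-- The residue field of a valuation subring of a field of characteristic `p` has characteristic `p`
(for any surjective residue map onto a field). [folklore] -/
theorem charP_of_residue_map [hp : Fact p.Prime] [CharP K p] (W : ValuationSubring K) {κ : Type} [Field κ]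
    (π : W →+* κ) : CharP κ p := by
  haveI : CharP W p := CharP.subring' K p W.toSubring
  have h0 : (p : κ) = 0 := by rw [← map_natCast π, CharP.cast_eq_zero, map_zero]
  exact (CharP.charP_iff_prime_eq_zero hp.out).mpr h0

/-- **Dévissage + ArcPlaces at the residual level.** `O ≤ W` valuation subrings of `K` (`char K = p`),
`π : W → κ` a residue map, and the residual ring of `O` is a valuation subring `V` of `κ` which is a DISCRETE
valuation ring with PERFECT residue field (every element of `V` is a `p`-th power modulo `𝔪_V`): then
`Unr p K W ≤ Unr p K O` — by `unr_eq_top_of_dvr_of_perfect_residue` (ArcPlaces) `V` absorbs `H³_p(κ)`.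
[folklore] -/
theorem unr_le_unr_of_residual_dvr_of_perfect_residue (hp : p.Prime) [CharP K p] {O W : ValuationSubring K}
    (hOW : O ≤ W) {κ : Type} [Field κ] (π : W →+* κ) (hπ : Function.Surjective π)
    (hker : ∀ x : W, π x = 0 ↔ (x : K) ∈ W.nonunits) (V : ValuationSubring κ)
    (hV : ∀ x : W, π x ∈ V ↔ (x : K) ∈ O) (hdvr : IsDiscreteValuationRing V)
    (hperf : ∀ u : κ, u ∈ V → ∃ e : κ, u - e ^ p ∈ V.nonunits) :
    Unr p K W.toSubring ≤ Unr p K O.toSubring := by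
  haveI := Fact.mk hp
  haveI : CharP κ p := charP_of_residue_map W π
  exact unr_le_unr_of_residual_absorption hOW π hπ hker V.toSubring hV
    (unr_eq_top_of_dvr_of_perfect_residue hp V hdvr hperf)

/-- **Dévissage + PerfectHullDense at the residual level.** `O ≤ W` valuation subrings of `K` (`char K = p`),
`π : W → κ` a residue map, and the residual ring of `O` is a valuation subring `V` of `κ` at which `κ` is DENSE IN
ITS PERFECT HULL ((a) `κ = κᵖ + V`, (b) `κˣ = (κˣ)ᵖ(1 + 𝔪_V)`, (c) `∀ a, ∀ m ∈ 𝔪_V ∖ 0, ∃ i, m^(pⁱ) a ∈ V` —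
the hypotheses of `unr_eq_top_of_dense_in_perfect_hull`): then `Unr p K W ≤ Unr p K O`. [folklore] -/
theorem unr_le_unr_of_residual_dense_in_perfect_hull (hp : p.Prime) [CharP K p] {O W : ValuationSubring K}
    (hOW : O ≤ W) {κ : Type} [Field κ] (π : W →+* κ) (hπ : Function.Surjective π)
    (hker : ∀ x : W, π x = 0 ↔ (x : K) ∈ W.nonunits) (V : ValuationSubring κ)
    (hV : ∀ x : W, π x ∈ V ↔ (x : K) ∈ O)
    (ha : ∀ a : κ, ∃ e n : κ, n ∈ V ∧ a = e ^ p + n)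
    (hb : ∀ b : κ, b ≠ 0 → ∃ B m : κ, B ≠ 0 ∧ m ∈ V.nonunits ∧ b = B ^ p * (1 + m))
    (hc : ∀ a m : κ, m ∈ V.nonunits → m ≠ 0 → ∃ i : ℕ, m ^ (p ^ i) * a ∈ V) :
    Unr p K W.toSubring ≤ Unr p K O.toSubring := by
  haveI := Fact.mk hp
  haveI : CharP κ p := charP_of_residue_map W π
  exact unr_le_unr_of_residual_absorption hOW π hπ hker V.toSubring hV
    (unr_eq_top_of_dense_in_perfect_hull hp.ne_zero V ha hb hc)

end Residual

/-! ## The coarsest non-integral level -/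

section Coarsest

variable {p : ℕ} {K : Type} [Field K]

/-- **`Unr` of a directed union is exhausted by the `Unr` of its members**: a class integral over the union of a
non-empty directed family of valuation rings is integral over one member (symbols have finite support).
[folklore] -/
theorem exists_mem_Unr_of_mem_Unr_iSup {ι : Type} [Nonempty ι] (V : ι → ValuationSubring K)
    (hdir : Directed (· ≤ ·) V) {α : G K ⧸ N p K}
    (hα : α ∈ Unr p K (⨆ i, (V i).toSubring)) : ∃ i, α ∈ Unr p K (V i).toSubring := by
  have hdir' : Directed (· ≤ ·) fun i => (V i).toSubring := fun i j =>
    let ⟨l, h1, h2⟩ := hdir i j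
    ⟨l, fun _ hx => h1 hx, fun _ hx => h2 hx⟩
  have hdirU : Directed (· ≤ ·) fun i => Unr p K (V i).toSubring := fun i j =>
    let ⟨l, h1, h2⟩ := hdir i j
    ⟨l, unr_le_unr_of_le h1, unr_le_unr_of_le h2⟩
  -- two members have a common upper member
  have hub : ∀ i j : ι, ∃ l, (V i).toSubring ≤ (V l).toSubring ∧ (V j).toSubring ≤ (V l).toSubring :=
    fun i j => hdir' i j
  have hle : Unr p K (⨆ i, (V i).toSubring) ≤ ⨆ i, Unr p K (V i).toSubring := by
    refine (AddSubgroup.closure_le _).mpr ?_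
    rintro _ ⟨a, b, c, ha, hb, hbi, hc, hci, rfl⟩
    obtain ⟨i₁, h₁⟩ := (Subring.mem_iSup_of_directed hdir').mp ha
    obtain ⟨i₂, h₂⟩ := (Subring.mem_iSup_of_directed hdir').mp hb
    obtain ⟨i₃, h₃⟩ := (Subring.mem_iSup_of_directed hdir').mp hbi
    obtain ⟨i₄, h₄⟩ := (Subring.mem_iSup_of_directed hdir').mp hc
    obtain ⟨i₅, h₅⟩ := (Subring.mem_iSup_of_directed hdir').mp hci
    obtain ⟨l₁, hl₁, hl₁'⟩ := hub i₁ i₂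
    obtain ⟨l₂, hl₂, hl₂'⟩ := hub l₁ i₃
    obtain ⟨l₃, hl₃, hl₃'⟩ := hub l₂ i₄
    obtain ⟨l, hl, hl'⟩ := hub l₃ i₅
    have hmem : ((FreeAbelianGroup.of (a, b, c) : G K) : G K ⧸ N p K) ∈ Unr p K (V l).toSubring :=
      sym_mem_Unr (hl (hl₃ (hl₂ (hl₁ h₁)))) (hl (hl₃ (hl₂ (hl₁' h₂)))) (hl (hl₃ (hl₂' h₃))) (hl (hl₃' h₄))
        (hl' h₅)
    exact (le_iSup (fun i => Unr p K (V i).toSubring) l) hmem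
  exact (AddSubgroup.mem_iSup_of_directed hdirU).mp (hle hα)

/-- **The coarsest non-integral level exists.** If `α ∉ Unr O` there is a coarsening `W ⊇ O` with `α ∉ Unr W`
which is maximal with this property: every strictly coarser `W'` has `α ∈ Unr W'` (Zorn over the overrings of
`O`; a chain is bounded by its union, over which `α` stays non-integral by `exists_mem_Unr_of_mem_Unr_iSup`).
[folklore] -/
theorem exists_coarsest_not_mem_Unr (O : ValuationSubring K) {α : G K ⧸ N p K}
    (hα : α ∉ Unr p K O.toSubring) :
    ∃ W : ValuationSubring K, O ≤ W ∧ α ∉ Unr p K W.toSubring ∧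
      ∀ W' : ValuationSubring K, W ≤ W' → α ∉ Unr p K W'.toSubring → W' = W := by
  set S : Set (ValuationSubring K) := {W | O ≤ W ∧ α ∉ Unr p K W.toSubring}
  -- every non-empty chain of such coarsenings is bounded by its union
  have hchain : ∀ c ⊆ S, IsChain (· ≤ ·) c → ∀ y ∈ c, ∃ ub ∈ S, ∀ z ∈ c, z ≤ ub := by
    intro c hcS hc y hy
    haveI : Nonempty c := ⟨⟨y, hy⟩⟩
    have hdir : Directed (· ≤ ·) fun V : c => (V : ValuationSubring K) :=
      directedOn_iff_directed.mp hc.directedOn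
    let U : Subring K := ⨆ V : c, (V : ValuationSubring K).toSubring
    have hyU : (y : ValuationSubring K).toSubring ≤ U :=
      le_iSup (fun V : c => (V : ValuationSubring K).toSubring) ⟨y, hy⟩
    have hOU : O.toSubring ≤ U := fun x hx => hyU ((hcS hy).1 hx)
    refine ⟨ValuationSubring.ofLE O U hOU, ⟨fun x hx => hOU hx, fun hmem => ?_⟩, fun z hz => ?_⟩
    · obtain ⟨⟨V, hV⟩, hαV⟩ :=
        exists_mem_Unr_of_mem_Unr_iSup (p := p) (fun V : c => (V : ValuationSubring K)) hdir hmem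
      exact (hcS hV).2 hαV
    · exact fun x hx => (le_iSup (fun V : c => (V : ValuationSubring K).toSubring) ⟨z, hz⟩) hx
  obtain ⟨W, hOW, hWmax⟩ := zorn_le_nonempty₀ S hchain O ⟨le_rfl, hα⟩
  exact ⟨W, hOW, hWmax.prop.2, fun W' hWW' hW' =>
    le_antisymm (hWmax.2 ⟨hOW.trans hWW', hW'⟩ hWW') hWW'⟩

end Coarsest

/-! ## Consequences for the crux -/

section Crux

variable {p : ℕ} {k K : Type} [Field k] [Field K] [Algebra k K]

/-- **Condition (D) is inherited by every coarsening**: the divisorial places tested for `(R, W)` are among those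
tested for `(R, O)` when `O ≤ W` (their centres lie inside `𝔪_W ∩ R ⊆ 𝔪_O ∩ R`). [folklore] -/
theorem divIntegral_of_le (R : Subalgebra k K) {O W : ValuationSubring K} (hOW : O ≤ W) {α : G K ⧸ N p K} (h : DivIntegral p k K R O α) : DivIntegral p k K R W α :=
  fun W' hk hdvr heft hR hcen => h W' hk hdvr heft hR fun x hx hxW' =>
    ValuationSubring.nonunits_le_nonunits.mpr hOW (hcen x hx hxW')

/-- **Witnesses ascend.** If `(R, O, α)` satisfies (D) and (N) and `O ≤ W` has absorbing residual place, then
`(R, W, α)` satisfies (D) and (N) — with `R ⊆ W` and `k ⊆ W`. [folklore] -/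
theorem witness_ascends (R : Subalgebra k K) {O W : ValuationSubring K} (hOW : O ≤ W)
    (hkO : ∀ c : k, algebraMap k K c ∈ O) (hRO : R.toSubring ≤ O.toSubring) {κ : Type} [Field κ]
    (π : W →+* κ) (hπ : Function.Surjective π) (hker : ∀ x : W, π x = 0 ↔ (x : K) ∈ W.nonunits)
    (Ō : Subring κ) (hŌ : ∀ x : W, π x ∈ Ō ↔ (x : K) ∈ O) (habs : Unr p κ Ō = ⊤) {α : G K ⧸ N p K}
    (hD : DivIntegral p k K R O α) (hN : α ∉ Unr p K O.toSubring) :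
    (∀ c : k, algebraMap k K c ∈ W) ∧ R.toSubring ≤ W.toSubring ∧ DivIntegral p k K R W α ∧
      α ∉ Unr p K W.toSubring :=
  ⟨fun c => hOW (hkO c), fun _ hx => hOW (hRO hx), divIntegral_of_le R hOW hD,
    not_mem_Unr_coarsening_of_residual_absorption hOW π hπ hker Ō hŌ habs hN⟩

/-- **CALIBRATION (negative lemma): no witness below a TESTED coarsening with absorbing residual place.** The
crux with the extra datum "a valuation ring `W ⊇ O` which is a DVR essentially of finite type over `k`, a residue
map `π : W → κ`, and the residual ring `Ō` of `O` absorbing `H³_p(κ)` (`Unr p κ Ō = ⊤`)" is FALSE: `W` contains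
`R` and `k`, its centre on `R` lies inside the centre of `O`, so (D) gives `α ∈ Unr W`, and the dévissage gives
`Unr W ≤ Unr O`, contradicting (N). [folklore] -/
theorem not_wildSymbol_below_absorbing_tested_coarsening :
    ¬ ∃ p : ℕ, p.Prime ∧ ∃ (k K : Type) (_ : Field k) (_ : CharP k p) (_ : PerfectField k) (_ : Field K)
      (_ : Algebra k K), (⊤ : IntermediateField k K).FG ∧ ∃ O : ValuationSubring K,
      (∀ c : k, algebraMap k K c ∈ O) ∧
      (∃ W : ValuationSubring K, O ≤ W ∧ IsDiscreteValuationRing W ∧ EssFiniteType k K W ∧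
        ∃ (κ : Type) (_ : Field κ) (π : W →+* κ), Function.Surjective π ∧
          (∀ x : W, π x = 0 ↔ (x : K) ∈ W.nonunits) ∧
          ∃ Ō : Subring κ, (∀ x : W, π x ∈ Ō ↔ (x : K) ∈ O) ∧ Unr p κ Ō = ⊤) ∧
      ∃ R : Subalgebra k K, R.FG ∧ R.toSubring ≤ O.toSubring ∧ IsFractionRing R K ∧
      ∃ α : G K ⧸ N p K, DivIntegral p k K R O α ∧ α ∉ Unr p K O.toSubring := by
  rintro ⟨p, -, k, K, _, _, _, _, _, -, O, hkO, ⟨W, hOW, hdvr, heft, κ, _, π, hπ, hker, Ō, hŌ, habs⟩,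
    R, -, hRO, -, α, hD, hN⟩
  obtain ⟨hkW, hRW, hDW, hNW⟩ := witness_ascends R hOW hkO hRO π hπ hker Ō hŌ habs hD hN
  exact hNW (hDW W hkW hdvr heft hRW fun x _ hx => hx)

/-- **CALIBRATION (negative lemma): no witness below a tested coarsening whose residual place is discrete with
perfect residue field.** E.g. the rank-two places "a prime divisor `E` of a model, followed by a closed point of
`E` (k perfect) or by a transcendental formal arc on `E`": they are exactly as dead as the divisorial place of `E`.
[folklore] -/
theorem not_wildSymbol_below_tested_coarsening_with_discrete_perfect_residual :
    ¬ ∃ p : ℕ, p.Prime ∧ ∃ (k K : Type) (_ : Field k) (_ : CharP k p) (_ : PerfectField k) (_ : Field K)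
      (_ : Algebra k K), (⊤ : IntermediateField k K).FG ∧ ∃ O : ValuationSubring K,
      (∀ c : k, algebraMap k K c ∈ O) ∧
      (∃ W : ValuationSubring K, O ≤ W ∧ IsDiscreteValuationRing W ∧ EssFiniteType k K W ∧
        ∃ (κ : Type) (_ : Field κ) (π : W →+* κ), Function.Surjective π ∧
          (∀ x : W, π x = 0 ↔ (x : K) ∈ W.nonunits) ∧
          ∃ V : ValuationSubring κ, (∀ x : W, π x ∈ V ↔ (x : K) ∈ O) ∧ IsDiscreteValuationRing V ∧
            ∀ u : κ, u ∈ V → ∃ e : κ, u - e ^ p ∈ V.nonunits) ∧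
      ∃ R : Subalgebra k K, R.FG ∧ R.toSubring ≤ O.toSubring ∧ IsFractionRing R K ∧
      ∃ α : G K ⧸ N p K, DivIntegral p k K R O α ∧ α ∉ Unr p K O.toSubring := by
  rintro ⟨p, hp, k, K, _, _, _, _, _, -, O, hkO,
    ⟨W, hOW, hdvr, heft, κ, _, π, hπ, hker, V, hV, hVdvr, hperf⟩, R, -, hRO, -, α, hD, hN⟩
  haveI : CharP K p := charP_of_injective_algebraMap (algebraMap k K).injective p
  have hle := unr_le_unr_of_residual_dvr_of_perfect_residue hp hOW π hπ hker V hV hVdvr hperf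
  have hkW : ∀ c : k, algebraMap k K c ∈ W := fun c => hOW (hkO c)
  have hRW : R.toSubring ≤ W.toSubring := fun _ hx => hOW (hRO hx)
  exact hN (hle (divIntegral_of_le R hOW hD W hkW hdvr heft hRW fun x _ hx => hx))

/-- **WLOG the witness sits at its coarsest non-integral level, and there no residual place absorbs.** From a
witness `(R, O, α)` ((D) and (N)) one gets a coarsening `W ⊇ O` such that `(R, W, α)` is again a witness
(`k ⊆ W`, `R ⊆ W`, (D), (N)), `α` is integral at every strictly coarser `W'`, and — by the dévissage — for every
strictly coarser `W'` and every residue map `π : W' → κ` the residual ring of `W` in `κ` does NOT absorb `H³_p(κ)`.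
[folklore] -/
theorem witness_at_coarsest_level (R : Subalgebra k K) {O : ValuationSubring K}
    (hkO : ∀ c : k, algebraMap k K c ∈ O) (hRO : R.toSubring ≤ O.toSubring) {α : G K ⧸ N p K}
    (hD : DivIntegral p k K R O α) (hN : α ∉ Unr p K O.toSubring) :
    ∃ W : ValuationSubring K, O ≤ W ∧ (∀ c : k, algebraMap k K c ∈ W) ∧ R.toSubring ≤ W.toSubring ∧
      DivIntegral p k K R W α ∧ α ∉ Unr p K W.toSubring ∧
      (∀ W' : ValuationSubring K, W ≤ W' → W' ≠ W → α ∈ Unr p K W'.toSubring) ∧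
      (∀ W' : ValuationSubring K, W ≤ W' → W' ≠ W → ∀ (κ : Type) (_ : Field κ) (π : W' →+* κ),
        Function.Surjective π → (∀ x : W', π x = 0 ↔ (x : K) ∈ W'.nonunits) →
        ∀ Ō : Subring κ, (∀ x : W', π x ∈ Ō ↔ (x : K) ∈ W) → Unr p κ Ō ≠ ⊤) := by
  obtain ⟨W, hOW, hNW, hmax⟩ := exists_coarsest_not_mem_Unr O hN
  have hint : ∀ W' : ValuationSubring K, W ≤ W' → W' ≠ W → α ∈ Unr p K W'.toSubring :=
    fun W' hle hne => by_contra fun h => hne (hmax W' hle h)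
  refine ⟨W, hOW, fun c => hOW (hkO c), fun _ hx => hOW (hRO hx), divIntegral_of_le R hOW hD, hNW, hint,
    fun W' hle hne κ _ π hπ hker Ō hŌ habs => ?_⟩
  exact hNW (unr_le_unr_of_residual_absorption hle π hπ hker Ō hŌ habs (hint W' hle hne))

/-- **The crux, sharpened for free: the witness may be taken at its coarsest non-integral level.** `WildSymbol` is
equivalent to the existence of a witness `(p, k, K, O, R, α)` such that, in addition, `α` is integral at EVERY
strictly coarser valuation ring `W' ⊋ O` (so either `O` has rank one, or the residual places of `O` on the residue
fields of its proper coarsenings do not absorb — `witness_at_coarsest_level`). [folklore] -/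
theorem wildSymbol_iff_coarsest :
    WildSymbol ↔ ∃ p : ℕ, p.Prime ∧ ∃ (k K : Type) (_ : Field k) (_ : CharP k p) (_ : PerfectField k)
      (_ : Field K) (_ : Algebra k K), (⊤ : IntermediateField k K).FG ∧ ∃ O : ValuationSubring K,
      (∀ c : k, algebraMap k K c ∈ O) ∧ ∃ R : Subalgebra k K, R.FG ∧ R.toSubring ≤ O.toSubring ∧
      IsFractionRing R K ∧ ∃ α : G K ⧸ N p K, DivIntegral p k K R O α ∧ α ∉ Unr p K O.toSubring ∧
      ∀ W' : ValuationSubring K, O ≤ W' → W' ≠ O → α ∈ Unr p K W'.toSubring := by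
  rw [wildSymbol_iff]
  constructor
  · rintro ⟨p, hp, k, K, ik, icp, ipf, iK, ialg, hfg, O, hkO, R, hR, hRO, hfr, α, hD, hN⟩
    obtain ⟨W, -, hkW, hRW, hDW, hNW, hint, -⟩ := witness_at_coarsest_level R hkO hRO hD hN
    exact ⟨p, hp, k, K, ik, icp, ipf, iK, ialg, hfg, W, hkW, R, hR, hRW, hfr, α, hDW, hNW, hint⟩
  · rintro ⟨p, hp, k, K, ik, icp, ipf, iK, ialg, hfg, O, hkO, R, hR, hRO, hfr, α, hD, hN, -⟩
    exact ⟨p, hp, k, K, ik, icp, ipf, iK, ialg, hfg, O, hkO, R, hR, hRO, hfr, α, hD, hN⟩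

end Crux

end Summit.ResolutionOfSingularities.ResolutionOfSingularities.Theorems.WildSymbol.Birth

end
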